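import Summits.HodgeConjecture.HodgeConjecture.Theorems.WeilTypeLadderProducts
import Literature.AlgebraicGeometry.HodgeTheory.WeilClassesTwistedSquare
import HarnessLib

/-!
# Weil-type ladder — TWISTED SQUARES: the rungs R1/R1′ (sixfolds), R2₈ (eightfolds) and R∞ (all `2g`) hold UNCONDITIONALLY on the loci `(T × T, φ × (-φ))`

B2b ladder `hodge-weil` (HOME `run/shared/lean/b2b/hodge-weil/`, CENSUS ## P3-g4, note `TWISTED-SQUARES.md` §6),
prover 3 generation 4 (strategy: special cases with CLASSICAL tools). Helper of the route item
`WeilSixfolds` (R1, stmt-HodgeConjecture-2524). No `sorry`, no definition, NO NAMED FACT: every theorem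
below is unconditional, resting on the tree's PROVED theorem
`Literature.AlgebraicGeometry.HodgeTheory.weilClassesOf_twistedSquare_le_algebraicClasses`
(`HodgeTheory/WeilClassesTwistedSquare`, p178040): for EVERY complex abelian variety `T` of dimension
`g ≥ 1` and every `φ : T ⟶ T` with `φ ≫ φ = -(d • 𝟙 T)`, `d ≥ 1`, the Weil plane of the twisted square
`(T × T, Φ = φ × (-φ))` — an abelian `2g`-fold of Weil type `(g, g)` for `K = ℚ(√-d)` acting through
`ι × ῑ` — consists of algebraic classes (the Weil line `E₊ = ⋀^{2g}(p₁^*V₊ ⊕ p₂^*V₋)` is spanned by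
`p₁^*(a₁⌣⋯⌣a_g) ⌣ p₂^*(b₁⌣⋯⌣b_g)`, a non-zero class extracted from the algebraic class
`(p₁ + p₂)^*[point]` by a polynomial in the pull-backs `(x·𝟙 + Φ)^*`).

## What is typed here (all unconditional)

* R1 = `WeilSixfolds` (stmt-2524) and R1′ = `NonsplitSixfolds` at the SIXFOLDS `(T × T, φ × (-φ))`, `T`
  any abelian THREEFOLD with `φ² = -d`: `weilSixfolds_body_twistedSquare`,
  `nonsplitSixfolds_body_twistedSquare` (the non-hyperbolicity hypothesis is carried, unused), and the
  `K`-isogeny-closed form `weilSixfolds_body_of_isogeny_twistedSquare`.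
* R2₈ = `SplitEightfolds` / R∞(`n = 4`) at the EIGHTFOLDS `(T × T) × S`, `S` an abelian surface of Weil
  type `(1,1)`: `splitEightfolds_body_twistedSquare_prod_surface` (downward product step p177044 +
  Lefschetz `(1,1)` for the surface, both PROVED in the tree); and at the eightfolds `(X × X, φ × (-φ))`,
  `X` any abelian FOURFOLD with `φ² = -d`: `splitEightfolds_body_twistedSquare_fourfold`.
* R∞ = `WeilClassesImaginaryQuadratic` at every twisted square `(T × T, φ × (-φ))`, `dim T = n`:
  `weilClassesImaginaryQuadratic_body_twistedSquare`.
* ON-PATH: `HodgeConjecture ⟹` each (cases of the summit; from `WeilTypeLadderOnPath` /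
  `WeilTypeLadderProducts`).

## Where these loci sit (pen-and-paper; discriminants are not on the carriers — packet note §2, §6)

For `(T, ι)` with `ι(√-d) = φ` of multiplicities `(n′, n″)`, `n′ + n″ = g`, every polarization `L` of a
`T` with `End⁰(T) ⊇ K` a CM field (e.g. `End⁰(T) = K`) is `K`-compatible, and the product polarization
`aL ⊞ bL` (`a, b ∈ ℚ_{>0}`) of `(T × T, ι × ῑ)` has van Geemen form `aH ⊕ b(-H̄)` of signature `(g, g)`
and determinant `(-1)^g (ab)^g (det H)²`; for `g` ODD its class in `ℚ^×/Nm(K^×)` is `-ab`, i.e. EVERY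
class (`twisted_square_disc.py`, exact). With van Geemen 5.3 / Markman §11.5 Step 1 ("two connected
components … the same discriminant, parametrize isogenous abelian varieties") and the isogeny-closed
form below: for every imaginary quadratic `K` and every `δ`, EVERY component `(K, 3, δ)` of the
`9`-dimensional moduli of polarized Weil-type sixfolds — split (`δ = -1`) or NON-split — contains the
`2`-dimensional locus of twisted squares of Picard-type threefolds (`End⁰(T) = K`, type `(2,1)`), on which
the Weil classes are algebraic by a KERNEL-CHECKED, FACT-FREE theorem. Gen-3's `5`-dimensional product
loci `X⁴ × S_D` needed Markman 2023 (refereed) or F1; gen-4's Tankeev–Ribet file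
(`WeilTypeLadderSimpleThreefoldSquares`, p177686) needed the named fact; this file needs NOTHING. For
`g = 4` the product polarizations are split (`(ab)^4` is a norm); other `K`-compatible polarizations of
`X × X̄` exist (`ρ ≥ 4`) and are not analysed here.

Honest framing: special `2`-dimensional (resp. `n′n″`-dimensional) loci, NOT general members ("outside
this locus [δ = -1], the Hodge conjecture for Weil classes on sixfolds remains completely open",
arXiv:2603.20268 p. 3 — for the general member, unchanged); these Weil classes are polynomials in divisor
classes (not exceptional in van Geemen's sense); unconditional RUNGS above the floor added: 0;
unconditional kernel-checked LOCI with algebraic Weil classes in every non-split component: yes.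
-/

noncomputable section

-- every declaration of this problem lives in Summit.HodgeConjecture.HodgeConjecture.… (summit = sub-problem)
set_option linter.dupNamespace false

open CategoryTheory
open Literature.AlgebraicGeometry Literature.AlgebraicGeometry.Motives
open Literature.AlgebraicGeometry.HodgeTheory
open Literature.AlgebraicTopology.SingularHomology

namespace Summit.HodgeConjecture.HodgeConjecture.WeilTypeLadder

/-! ### Sixfolds `(T × T, φ × (-φ))`, `T` an abelian threefold -/

section Sixfolds

variable {T : AbelianVariety ℂ} {d : ℕ} {φ : T ⟶ T}

/-- **Rung R1 (`WeilSixfolds`, stmt-HodgeConjecture-2524) AT the twisted squares of abelian THREEFOLDS —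
UNCONDITIONAL.** For every complex abelian threefold `T` and `φ ≫ φ = -(d • 𝟙 T)`, `d ≥ 1`, every
rational `(3,3)`-class of the Weil plane of the sixfold `(T × T, φ × (-φ))` is algebraic (body of
`WeilSixfolds` in its `weilClassesOf` form at these sixfolds). [cite: vanGeemen1994HodgeAV, 4.9 and Lemma 5.2]
[cite: Schoen1998HodgeWeilAddendum, §10] -/
theorem weilSixfolds_body_twistedSquare (hT : T.dim = 3) (hd : 0 < d) (hφ : φ ≫ φ = -(d • 𝟙 T)) :
    ∀ c : complexBetti (T.prod T).X (2 * 3), IsRationalClass c →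
      IsOfHodgeType (2 * 3) (T.prod T).X (2 * 3) 3 3 c →
        c ∈ weilClassesOf (T.prod T)
          (AbelianVariety.prodLift (AbelianVariety.fst T T ≫ φ) (AbelianVariety.snd T T ≫ (-φ))) 3 d →
          c ∈ algebraicClasses (T.prod T).X 3 :=
  mem_algebraicClasses_of_mem_weilClassesOf_twistedSquare (by norm_num) hT hd hφ

/-- **Rung R1′ (`NonsplitSixfolds`) AT the twisted squares of abelian threefolds — UNCONDITIONAL**: its body
verbatim for `A = T × T`, `φ_A = φ × (-φ)` (the non-hyperbolicity hypothesis is carried and NOT used). By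
the discriminant count of the module docstring these sixfolds lie in EVERY non-split component
`(K, 3, δ ≠ -1)`, every `K`: a fact-free kernel-checked sub-case of R1′ on a `2`-dimensional locus; R1′ for
the general member is untouched. [cite: Markman2025SurveySecant, §1.1 and §11.5 Step 1]
[cite: vanGeemen1994HodgeAV, Lemma 5.2 and 5.3–5.4] -/
theorem nonsplitSixfolds_body_twistedSquare (hT : T.dim = 3) :
    ∀ (d : ℕ), 0 < d → ∀ (ψ : T ⟶ T), ψ ≫ ψ = -(d • 𝟙 T) →
      (T.prod T).dim = 2 * 3 →
      Motives.IsSmoothProjective (2 * 3) (T.prod T).X →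
        (∀ (e : Motives.ProjectiveEmbedding (T.prod T).X)
          (a : complexBetti (Motives.projectiveSpace e.n ℂ) 2), IsRationalClass a → a ≠ 0 →
            ¬ Motives.IsHyperbolicWeilType (T.prod T)
              (AbelianVariety.prodLift (AbelianVariety.fst T T ≫ ψ) (AbelianVariety.snd T T ≫ (-ψ))) 3
              ((d : ℂ) • complexBetti.map e.ι 2 a +
                complexBetti.map (AbelianVariety.prodLift (AbelianVariety.fst T T ≫ ψ)
                  (AbelianVariety.snd T T ≫ (-ψ))).hom.hom.hom 2 (complexBetti.map e.ι 2 a))) →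
          ∀ c : complexBetti (T.prod T).X (2 * 3), IsRationalClass c →
            IsOfHodgeType (2 * 3) (T.prod T).X (2 * 3) 3 3 c →
              c ∈ weilClassesOf (T.prod T)
                (AbelianVariety.prodLift (AbelianVariety.fst T T ≫ ψ) (AbelianVariety.snd T T ≫ (-ψ))) 3 d →
              c ∈ algebraicClasses (T.prod T).X 3 :=
  fun _ hd _ hψ _ _ _ ↦ weilSixfolds_body_twistedSquare hT hd hψ

/-- **Isogeny-closed form**: every sixfold `(A, φ_A)` with a `K`-equivariant isogeny pair towards a
twisted square of a threefold (`f : A ⟶ T × T` flat, `g : T × T ⟶ A`, `g ≫ φ_A = (φ × (-φ)) ≫ g`,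
`f ≫ g = m • 𝟙 A`, `m ≥ 1`) satisfies the body of R1/R1′ — UNCONDITIONALLY (isogeny descent
`mem_algebraicClasses_of_isogeny_of_mem_weilClassesOf`, proved in the tree). Markman §11.5 Step 1:
components with the same `(n, K, det H)` "parametrize isogenous abelian varieties [van-Geemen]".
[cite: Markman2025SurveySecant, §11.5 Step 1] [cite: vanGeemen1994HodgeAV, 5.3] -/
theorem weilSixfolds_body_of_isogeny_twistedSquare (hT : T.dim = 3) (hd : 0 < d)
    (hφ : φ ≫ φ = -(d • 𝟙 T)) {A : AbelianVariety ℂ} {φA : A ⟶ A} (hA : A.dim = 2 * 3)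
    (MB : HodgeModel (2 * 3) (T.prod T).X) (f : A ⟶ T.prod T) (g : T.prod T ⟶ A)
    [AlgebraicGeometry.Flat f.hom.hom.hom.left]
    (hg : g ≫ φA = AbelianVariety.prodLift (AbelianVariety.fst T T ≫ φ) (AbelianVariety.snd T T ≫ (-φ)) ≫ g)
    {m : ℕ} (hm : 0 < m) (hfg : f ≫ g = m • 𝟙 A) :
    ∀ c : complexBetti A.X (2 * 3), IsRationalClass c → IsOfHodgeType (2 * 3) A.X (2 * 3) 3 3 c →
      c ∈ weilClassesOf A φA 3 d → c ∈ algebraicClasses A.X 3 :=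
  fun _ hc hcH hcW ↦
    mem_algebraicClasses_of_isogeny_of_mem_weilClassesOf (Motives.isSmoothProjective_of_dim_eq' hA)
      (Motives.isSmoothProjective_of_dim_eq' (dim_twistedSquare hT)) MB f g hg hm hfg
      (weilSixfolds_body_twistedSquare hT hd hφ) hc hcH hcW

/-- ON-PATH: `HodgeConjecture` ⟹ the R1-body statement at every twisted square `(T × T, φ × (-φ))`,
`dim T = 3` (via R∞ at `n = 3`); the theorems above are CASES of the summit. -/
theorem weilSixfolds_body_twistedSquare_of_hodgeConjecture (h : _root_.HodgeConjecture) (hT : T.dim = 3)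
    (hd : 0 < d) (hφ : φ ≫ φ = -(d • 𝟙 T)) :
    ∀ c : complexBetti (T.prod T).X (2 * 3), IsRationalClass c →
      IsOfHodgeType (2 * 3) (T.prod T).X (2 * 3) 3 3 c →
        c ∈ weilClassesOf (T.prod T)
          (AbelianVariety.prodLift (AbelianVariety.fst T T ≫ φ) (AbelianVariety.snd T T ≫ (-φ))) 3 d →
          c ∈ algebraicClasses (T.prod T).X 3 :=
  have hdim : (T.prod T).dim = 2 * 3 := dim_twistedSquare hT
  weilClassesImaginaryQuadratic_of_hodgeConjecture h 3 (by norm_num) d hd (T.prod T) _ hdim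
    (Motives.isSmoothProjective_of_dim_eq' hdim) (twistedSquare_comp_self hφ)

/-- ARROW: R1 (`WeilSixfolds`) itself gives the statement at twisted squares (no structure used). -/
theorem weilSixfolds_body_twistedSquare_of_weilSixfolds (h : Theses.SevenfoldWeilCensus.WeilSixfolds)
    (hT : T.dim = 3) (hd : 0 < d) (hφ : φ ≫ φ = -(d • 𝟙 T)) :
    ∀ c : complexBetti (T.prod T).X (2 * 3), IsRationalClass c →
      IsOfHodgeType (2 * 3) (T.prod T).X (2 * 3) 3 3 c →
        c ∈ weilClassesOf (T.prod T)
          (AbelianVariety.prodLift (AbelianVariety.fst T T ≫ φ) (AbelianVariety.snd T T ≫ (-φ))) 3 d →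
          c ∈ algebraicClasses (T.prod T).X 3 :=
  have hdim : (T.prod T).dim = 2 * 3 := dim_twistedSquare hT
  weilSixfolds_iff_weilClassesOf.1 h d hd (T.prod T) _ hdim (Motives.isSmoothProjective_of_dim_eq' hdim)
    (twistedSquare_comp_self hφ)

end Sixfolds

/-! ### Eightfolds: `(T × T) × S` and `(X × X, φ × (-φ))` -/

section Eightfolds

variable {T X S : AbelianVariety ℂ} {d : ℕ} {φ : T ⟶ T} {χ : X ⟶ X} {ψ : S ⟶ S}

/-- **Rung R2₈ (`SplitEightfolds`) / R∞ at `n = 4` on the EIGHTFOLDS `(T × T) × S` — UNCONDITIONAL**: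
`T` any abelian threefold with `φ² = -d`, `S` any abelian SURFACE with `ψ² = -d` of type `(1,1)`; every
rational `(4,4)`-class of the Weil plane of `((T × T) × S, (φ × (-φ)) × ψ)` is algebraic — by the tree's
downward product step (`weilClassesOf_prod_le_algebraicClasses`, Schoen 1998 §10 read downward) fed with
the twisted-square theorem and the unconditional surface case (Lefschetz `(1,1)`, proved in the tree).
No hypothesis on polarizations: with `S ∈ {E², S_D}` discriminants multiply to every eightfold class, so
every component `(K, 4, δ)` contains these `3`-dimensional loci (packet note §3, §6).
[cite: Schoen1998HodgeWeilAddendum, §10] [cite: Markman2025SurveySecant, §11.5 Steps 1–2] -/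
theorem splitEightfolds_body_twistedSquare_prod_surface (hT : T.dim = 3) (hd : 0 < d)
    (hφ : φ ≫ φ = -(d • 𝟙 T)) (hS : S.dim = 2 * 1) (hψ : ψ ≫ ψ = -(d • 𝟙 S))
    (hSbal : Module.finrank ℂ ↥(Module.End.eigenspace (complexBetti.map ψ.hom.hom.hom 1).hom
          (Complex.I * (Real.sqrt d : ℂ)) ⊓ hodgeOneZero (Motives.isSmoothProjective_of_dim_eq' hS)) = 1) :
    ∀ c : complexBetti ((T.prod T).prod S).X (2 * 4), IsRationalClass c →
      IsOfHodgeType (2 * 4) ((T.prod T).prod S).X (2 * 4) 4 4 c →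
        c ∈ weilClassesOf ((T.prod T).prod S)
          (AbelianVariety.prodLift
            (AbelianVariety.fst (T.prod T) S ≫
              AbelianVariety.prodLift (AbelianVariety.fst T T ≫ φ) (AbelianVariety.snd T T ≫ (-φ)))
            (AbelianVariety.snd (T.prod T) S ≫ ψ)) 4 d →
          c ∈ algebraicClasses ((T.prod T).prod S).X 4 :=
  fun _ _ _ hcW ↦
    weilClassesOf_prod_le_algebraicClasses (by norm_num) hd (dim_twistedSquare hT) hS
      (twistedSquare_comp_self hφ) hψ
      (weilClassesOf_twistedSquare_le_algebraicClasses (by norm_num) hT hd hφ)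
      (weilClassesOf_le_algebraicClasses_surface hS hd hψ hSbal) hcW

/-- **Rung R2₈ / R∞(`n = 4`) at the twisted squares `(X × X, χ × (-χ))` of abelian FOURFOLDS —
UNCONDITIONAL**: for every complex abelian fourfold `X` (e.g. a Weil-type `(2,2)` fourfold, whose own Weil
classes are NOT known classically) and `χ ≫ χ = -(d • 𝟙 X)`, the Weil classes of the eightfold
`(X × X, χ × (-χ))` are algebraic. (For `g = 4` the product polarizations are split; module docstring.)
[cite: vanGeemen1994HodgeAV, 4.9 and Lemma 5.2] -/
theorem splitEightfolds_body_twistedSquare_fourfold (hX : X.dim = 4) (hd : 0 < d)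
    (hχ : χ ≫ χ = -(d • 𝟙 X)) :
    ∀ c : complexBetti (X.prod X).X (2 * 4), IsRationalClass c →
      IsOfHodgeType (2 * 4) (X.prod X).X (2 * 4) 4 4 c →
        c ∈ weilClassesOf (X.prod X)
          (AbelianVariety.prodLift (AbelianVariety.fst X X ≫ χ) (AbelianVariety.snd X X ≫ (-χ))) 4 d →
          c ∈ algebraicClasses (X.prod X).X 4 :=
  mem_algebraicClasses_of_mem_weilClassesOf_twistedSquare (by norm_num) hX hd hχ

/-- ON-PATH (eightfolds `(T × T) × S`): `HodgeConjecture` ⟹ the statement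
(`splitEightfolds_prod_of_hodgeConjecture` at `3 + 1 = 4`). -/
theorem splitEightfolds_body_twistedSquare_prod_surface_of_hodgeConjecture (h : _root_.HodgeConjecture)
    (hT : T.dim = 3) (hS : S.dim = 2 * 1) (hd : 0 < d) (hφ : φ ≫ φ = -(d • 𝟙 T))
    (hψ : ψ ≫ ψ = -(d • 𝟙 S)) :
    ∀ c : complexBetti ((T.prod T).prod S).X (2 * 4), IsRationalClass c →
      IsOfHodgeType (2 * 4) ((T.prod T).prod S).X (2 * 4) 4 4 c →
        c ∈ weilClassesOf ((T.prod T).prod S)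
          (AbelianVariety.prodLift
            (AbelianVariety.fst (T.prod T) S ≫
              AbelianVariety.prodLift (AbelianVariety.fst T T ≫ φ) (AbelianVariety.snd T T ≫ (-φ)))
            (AbelianVariety.snd (T.prod T) S ≫ ψ)) 4 d →
          c ∈ algebraicClasses ((T.prod T).prod S).X 4 :=
  splitEightfolds_prod_of_hodgeConjecture h (show 3 + 1 = 4 from rfl) hd (dim_twistedSquare hT) hS
    (twistedSquare_comp_self hφ) hψ

end Eightfolds

/-! ### All dimensions: R∞ at twisted squares -/

section AllDimensions

variable {T : AbelianVariety ℂ} {n d : ℕ} {φ : T ⟶ T}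

/-- **Rung R∞ (`WeilClassesImaginaryQuadratic`) AT every twisted square — UNCONDITIONAL**: for every
`n ≥ 1`, every complex abelian `n`-fold `T` and `φ ≫ φ = -(d • 𝟙 T)`, `d ≥ 1`, every rational `(n,n)`-class
of the Weil plane of the `2n`-fold `(T × T, φ × (-φ))` is algebraic (R∞'s body at `A = T × T`; for `n`
odd these loci meet every component `(K, n, δ)`). [cite: vanGeemen1994HodgeAV, 4.9 and Lemma 5.2]
[cite: Weil1977HodgeRing] -/
theorem weilClassesImaginaryQuadratic_body_twistedSquare (hn : 0 < n) (hT : T.dim = n) (hd : 0 < d)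
    (hφ : φ ≫ φ = -(d • 𝟙 T)) :
    ∀ c : complexBetti (T.prod T).X (2 * n), IsRationalClass c →
      IsOfHodgeType (2 * n) (T.prod T).X (2 * n) n n c →
        c ∈ weilClassesOf (T.prod T)
          (AbelianVariety.prodLift (AbelianVariety.fst T T ≫ φ) (AbelianVariety.snd T T ≫ (-φ))) n d →
          c ∈ algebraicClasses (T.prod T).X n :=
  mem_algebraicClasses_of_mem_weilClassesOf_twistedSquare hn hT hd hφ

/-- ON-PATH: `HodgeConjecture` ⟹ the R∞-body statement at every twisted square (`n ≥ 2`). -/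
theorem weilClassesImaginaryQuadratic_body_twistedSquare_of_hodgeConjecture (h : _root_.HodgeConjecture)
    (hn : 2 ≤ n) (hT : T.dim = n) (hd : 0 < d) (hφ : φ ≫ φ = -(d • 𝟙 T)) :
    ∀ c : complexBetti (T.prod T).X (2 * n), IsRationalClass c →
      IsOfHodgeType (2 * n) (T.prod T).X (2 * n) n n c →
        c ∈ weilClassesOf (T.prod T)
          (AbelianVariety.prodLift (AbelianVariety.fst T T ≫ φ) (AbelianVariety.snd T T ≫ (-φ))) n d →
          c ∈ algebraicClasses (T.prod T).X n :=
  have hdim : (T.prod T).dim = 2 * n := dim_twistedSquare hT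
  weilClassesImaginaryQuadratic_of_hodgeConjecture h n hn d hd (T.prod T) _ hdim
    (Motives.isSmoothProjective_of_dim_eq' hdim) (twistedSquare_comp_self hφ)

end AllDimensions

end Summit.HodgeConjecture.HodgeConjecture.WeilTypeLadder

end
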